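import Summits.HodgeConjecture.HodgeConjecture.Cruxes.FormalLiftingFromClassLifting.Disproof
import Literature.AlgebraicGeometry.Motives.HodgeSheaves

/-!
# Line `syntomic-staircase` — skeleton for crux `FormalLiftingFromClassLifting` (stmt-HodgeConjecture-13825)

Route `PadicSemiregularLift`, crux P1a `FormalLiftingFromClassLifting` (rank 2): for `k` perfect of
characteristic `p`, `𝒳/W(k)` a smooth projective model of relative dimension `d`, `d + 6 < p`, with
`p`-torsion-free `H^b(𝒳,𝒪)`, `H^b(𝒳,Ω¹)` and (`d ≤ 3` ∨ `Ω¹` free), and a finite locally free `E₁`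
on `X_k` satisfying (⋆) CLASS-LIFTS-IMPLY-OBJECT-LIFTS whose rational class pro-lifts to
`(lim_n K₀(X_n)) ⊗ ℚ`, conclude `LiftsFormally 𝒳 E₁`.

Idea `syntomic-staircase` (`Cruxes/FormalLiftingFromClassLifting/Ideas/syntomic-staircase.md`;
triage r1-1/2/3: pass ×3). LEVER (paper): compute the relative `K`-theory of the `p`-adic tower
`X_m = 𝒳 ⊗ W/p^m` LEVEL-WISE and INTEGRALLY by filtered Dundas–Goodwillie–McCarthy (Bouis
arXiv:2412.06635 Prop. 3.29) + BMS2 graded pieces + Antieau–Mathew–Morrow–Nikolaus Thm F(2)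
(arXiv:2003.12541: `ℤ_p(r)(R) ≃ fib(φ/p^r − 1 : LΩ^{≥r}_R → LΩ_R)`, `r ≤ p − 2`, any quasisyntomic
`R`) + the filtered crystalline comparison (`LΩ_{X_m} ≃ RΓ(𝒳̂, Ω•)` independent of `m`,
`LΩ^{≥r}_{X_m} ≃ RΓ(𝒳̂, Fil^r_m)`, `Fil^r_m = [p^{m(r−j)⁺}Ω^j]_j`, PD-filtration of `(p^m)` = `p`-adic
in PD-degrees `≤ p − 1`): the Frobenius term CANCELS in every relative term, so
`gr^r K(X_m, X_k) ≃ RΓ(𝒳̂, Fil^r_1/Fil^r_m)[2r−1]` — a staircase of subquotients of the `p`-filtered de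
Rham complex of the lift; torsion-free Hodge cohomology makes the staircase LINEAR ALGEBRA
(`H^n(𝒳, Fil^r_m) = Σ_j p^{m(r−j)⁺}F^jH^n_dR(𝒳/W)`, triage r1-2 F2), whence surjective transitions of
the kernel tower and a torsion-free pro-obstruction group.

LEAN FACE. The syntomic/TC/motivic objects of the lever have no carrier in Mathlib or the tree, so
(as triage r1-3 F1 predicted) the typed skeleton is the lever's `K₀`-SPINE, cut along the standing
disprover's proved reduction `Disproof.crux_of_oneK_twoK` (crux ⟸ hyps → RationalProLift →
(1_K) IntegralCompatibleLift ∧ (2_K) KernelTowerSurjective), with the Hodge-torsion hypothesis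
NORMALISED first:

* `stub_hodgeTorsionFree` [M] — the typed torsion hypotheses (`𝒪`, `Ω¹`, `d ≤ 3 ∨ Ω¹ free`) give
  `p`-torsion-freeness of EVERY `H^b(𝒳, Ω^a_{𝒳/W})`, `a ≥ 2` (carrier `Motives.hodgeCohomology`, which
  the route item lacked when it was typed): Grothendieck–Serre duality over the DVR `W` +
  `Ω^a ≅ (Ω^{d−a})^∨ ⊗ Ω^d`; `Ω¹` free ⇒ `Ω^a` free. It discharges the typed disjunction once, so that
  the two `K`-theoretic stubs are stated under FULL Hodge torsion-freeness (Bloch–Esnault–Kerz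
  Rem. 35(2)), the hypothesis the staircase actually consumes (all columns `j < r ≤ d + 1`).
* `stub_kernelClassesLift` [XL, HARDEST; = ML of the idea card = Disproof (2_K)] — under full Hodge
  torsion-freeness every class in `K₀(X_{n+1})` dying on `X_k` is a restriction from `K₀(X_{n+2})`.
  Paper modules: (A1) the staircase dictionary, (A2) the lattice lemma, (A3) degeneration /
  strictness of the relative motivic spectral sequence in weights `≤ d + 1 < p − 1` (Adams) — (A3) is
  the one input not settled on paper by the triage (r1-1 F2, r1-2 F2, r1-3 summary).
* `stub_proImageSaturated` [L; = IPL of the idea card ⟺ Disproof (1_K) for all `E₁`] — under the same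
  hypotheses the image of `lim_n K₀(X_n) → K₀(X_k)` is SATURATED (`N·x` pro-lifts, `N ≠ 0` ⇒ `x`
  pro-lifts): BEK §9–11 integral PRO-isomorphism (Claim 49, `a < p − 2`) + torsion-freeness of the
  pro-obstruction group `⊕_r H^{2r}(𝒳, p(r)Ω^{<r})` + no extension torsion.

PROVED here (no `sorry`): `hodgeTorsionFree_all` (typed + stub 1 ⇒ full torsion-freeness, via
`hodgeCohomology{Zero,One}AddEquiv`); the identification of the crux's `KTheory` tower with the
`WittScheme` tower (`toWitt`, `thickeningMap_eq_thickeningTransition`,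
`map_specialFibreToThickening_toWitt`); CLEARING DENOMINATORS
`exists_int_multiple_proLift_of_rationalProLift` (the crux's rational pro-class `ξ ∈ ℚ ⊗ lim K₀(X_n)`
yields `N ≠ 0` and an INTEGRAL compatible family through `N·[E₁]`, by `IsLocalizedModule` on
`ℚ ⊗_ℤ −`); the composition `oneK_twoK_of_stubs : S1 → S2 → S3 → (hyps ⇒ RationalProLift ⇒ (1_K) ∧ (2_K))`
(kernel-checked, axioms `propext/Classical.choice/Quot.sound`) and — the ONLY theorem concluding the
crux — `FormalLiftingFromClassLifting_of : FormalLiftingFromClassLifting := crux_of_oneK_twoK (oneK_twoK_of_stubs stub₁ stub₂ stub₃)`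
(the crux BY NAME from the three stubs by name; `sorryAx` enters only through `stub_*`).

DISPROOF USED (`Cruxes/FormalLiftingFromClassLifting/Disproof.lean`; cycle 1 rev 3 read at start,
CYCLE 2 (2026-08-16T01:01Z, §§6–9 + docblock (A)–(G)) read at the publishing boundary and imported):
glue = `crux_of_oneK_twoK` + `specialFibreToThickening_comp_thickeningMap`; the cut S2/S3 is the
disprover's "SUGGESTED SPLIT (cycle 1, still apt)" verbatim. Cycle 2 UPGRADES both K-stubs for
`d ≤ 3` to paper theorems modulo the assembly (F1) = (A1): (E1) dimension count — the only
weight-crossing differential touching `π₀/π₋₁` is `d₁ : π₀gr¹ → π₋₁gr²`; (E3) it vanishes because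
`π₀K(X_m,X_1) → π₀gr¹ = ker(Pic X_m → Pic X_1)` is the relative determinant, surjective (weight 1 is
object-realised); (E2) = (A2); (E4) ⇒ stub 2 via `surjective_of_surjective_sub_quot`; (E5) ⇒ stub 3
via `noTorsion_of_extension` + `ob_eq_zero_of_rational_lift` (`G_∞ = π₋₁ lim K(X_m,X_1)` is an
extension of `H²(𝒳,𝒪)` by `H³(𝒳,Ω¹)`). So (A3) = [Deg] is EMPTY for `d ≤ 3` and real only on the
`Ω¹`-free branch `d ≥ 4` (E7), where `[-1]`-parity closes it on abelian schemes
(`eq_zero_of_weights`) and the OPEN EDGE is a non-trivial torsor under an abelian scheme over an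
infinite non-closed perfect `k`; the Adams escape is `eq_zero_of_weights_of_torsion` /
`weights_one_two_coprime`. `eTwoSurjective_not_sufficient` (graded surjectivity ≠ surjectivity) is
why no "graded" stub is registered here. `not_crux_of_oneStepWitness` (the formal kill criterion:
one `E₁` with a rational pro-lift whose class does not lift to `K₀(X_2)`, modulo
`VectorBundleConverse`) cannot fire if stub 3 holds: saturation gives `[E₁] ∈ im_∞ ⊂ im(K₀(X_2))`,
i.e. `OneStepClassLift`, for every rationally pro-liftable class.
`rechoice_needs_kernelTower` honoured (stub 2 IS the kernel-tower statement, not dropped);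
`not_cruxWithoutStar` honoured ((⋆) is consumed by the disprover's proved
`liftsFormally_of_integralStepClassLifting`; no stub mentions objects, and S2 ∧ S3 alone do not give
`LiftsFormally`); `CruxWithoutRationalProLift` honoured (the rational pro-class is consumed in
`exists_int_multiple_proLift_of_rationalProLift`, feeding stub 3); `CruxWithoutTorsionFreeO`
honoured (`H²(𝒳,𝒪)[p] = 0` is used at stub 2 — weight-1 Pic Bockstein — and at stub 3 — weight-1
pro-obstruction group `H²(𝒳,𝒪)` — and the Godeaux–Serre witness of refuter rattack-1498-0 violates
both stubs' hypothesis, not their conclusion-under-hypothesis). No Negative lemma has landed under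
`Theorems/FormalLiftingFromClassLifting/Negative/` (none exists, `ledger negatives`: 2 unrelated).
The disprover's cycle-2 lead (Angeltveit `K₃(W_n,(p)) ≅ W_{2(n−1)}` vs BEK's level-`n` term) is the
PD-staircase itself (triage r1-1 F1, r1-2 F1, r1-3 F3): it does not bite stub 2 at the
hypercohomology level (r1-3 F3b), only a failure of (A1)/(A3) at level-wise integral `K₀` could.
-/

set_option linter.dupNamespace false

namespace Summit.HodgeConjecture.HodgeConjecture.Cruxes.FormalLiftingFromClassLifting.SyntomicStaircase

open CategoryTheory AlgebraicGeometry Limits TensorProduct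
open Literature.AlgebraicGeometry
open Literature.AlgebraicGeometry.Motives Literature.AlgebraicGeometry.Motives.WittScheme
open Summit.HodgeConjecture.HodgeConjecture.Theses.PadicSemiregularLift
open Summit.HodgeConjecture.HodgeConjecture.Cruxes.FormalLiftingFromClassLifting.Disproof

/-! ## The three registered stubs -/

/-- **stub_hodgeTorsionFree** (size M; coherent duality — the normalisation of the typed torsion
hypothesis). For `k` perfect of characteristic `p` and `𝒳/W(k)` a smooth proper model of relative
dimension `d`, projective over `W`, with `p`-torsion-free `H^b(𝒳, 𝒪)` and `H^b(𝒳, Ω¹_{𝒳/W})` for all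
`b` and (`d ≤ 3` ∨ `Ω¹_{𝒳/W} ≅ 𝒪^d`): EVERY Hodge cohomology group `H^b(𝒳, Ω^a_{𝒳/W})` with `a ≥ 2`
(`Motives.hodgeCohomology 𝒳 a b`, `Ω^a = ⋀^a Ω¹`) is `p`-torsion-free.
Paper proof: `Ω¹` locally free of rank `d` (smoothness), so `Ω^a = 0` for `a > d`; if `Ω¹ ≅ 𝒪^d` then
`Ω^a ≅ 𝒪^{C(d,a)}` and `H^b(Ω^a) ≅ H^b(𝒪)^{C(d,a)}`; if `d ≤ 3` the remaining sheaves are `Ω^d = ω` and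
(`d = 3`) `Ω²`, and Grothendieck–Serre duality for the smooth projective `f : 𝒳 → Spec W` over the DVR
`W = W(k)` (`RΓ(𝒳, F^∨ ⊗ ω)[d] ≅ RHom_W(RΓ(𝒳, F), W)`, `(Ω^{d−a})^∨ ⊗ ω ≅ Ω^a`) with the universal
coefficient sequence over the PID `W` gives `H^b(Ω^a)_tors ≅ Ext¹_W(H^{d+1−b}(Ω^{d−a})_tors, W)`, which
vanishes by the hypotheses on `𝒪` (`a = d`) and `Ω¹` (`a = 2, d = 3`). Sources: Conrad, *Grothendieck
Duality and Base Change* (LNM 1750, 2000, doi:10.1007/b75857) Thm 4.3.1 (materialised p. 210: for a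
proper CM morphism of pure relative dimension over a locally noetherian base the duality morphism
`θ'_f : Rf_* RHom(F, ω_f[n] ⊗ f^*G) → RHom(Rf_* F, G)` is an isomorphism) = [RD] VII 3.4;
Hartshorne III.7; Bloch–Esnault–Kerz arXiv:1203.2776 Rem. 35(2) (the hypothesis in this form). -/
theorem stub_hodgeTorsionFree :
    ∀ (p : ℕ) [Fact p.Prime] (k : Type) [Field k] [CharP k p] [PerfectRing k p] (d : ℕ)
      (𝒳 : SchemeOver (WittVector p k)), IsSmoothProperModel d 𝒳 →
      Crystalline.IsProjectiveOverRing 𝒳 →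
      (∀ (b : ℕ) (x : structureSheafCohomology 𝒳.left b), (p : ℤ) • x = 0 → x = 0) →
      (∀ (b : ℕ) (x : hodgeCohomologyOne 𝒳 b), (p : ℤ) • x = 0 → x = 0) →
      (d ≤ 3 ∨ Nonempty (cotangentSheaf 𝒳 ≅ SheafOfModules.free (R := 𝒳.left.ringCatSheaf) (Fin d))) →
      ∀ (a b : ℕ), 2 ≤ a → ∀ x : hodgeCohomology 𝒳 a b, (p : ℤ) • x = 0 → x = 0 := by
  sorry

/-- **stub_kernelClassesLift** (size XL; HARDEST — the syntomic staircase proper; = the idea card's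
master lemma ML, equivalent to the disprover's (2_K) `KernelTowerSurjective`). For `k` perfect,
`𝒳/W(k)` a smooth proper model of relative dimension `d`, projective, `d + 6 < p`, with ALL Hodge
cohomology groups `H^b(𝒳, Ω^a_{𝒳/W})` `p`-torsion-free: every class `t ∈ K₀(X_{n+1})`
(`X_{n+1} = 𝒳 ⊗ W/p^{n+1}`) whose restriction to the special fibre `X_k` vanishes is the restriction of
a class on `X_{n+2}`. Equivalently: the transition maps of the pro-system `ker(K₀(X_m) → K₀(X_k))` are
surjective; equivalently: a class lifts one step iff its restriction to `X_k` does.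
Paper proof (the line): (A1) `π₀K(X_m, X_1)` carries the finite motivic filtration (weights
`1 ≤ r ≤ d + 1 ≤ p − 6`) with `gr^r ≃ H^{2r−1}(𝒳̂, Fil^r_1/Fil^r_m)`-type pieces (filtered DGM + BMS2 +
AMMN Thm F(2) + crystalline/PD comparison: NO Frobenius in the relative term); (A2) torsion-free
Hodge cohomology ⇒ `H^n(𝒳, Fil^r_m)` is free and injects into `H^n_dR(𝒳/W)` with image
`Σ_j p^{m(r−j)⁺}F^j`, so `H^{2r−1}(Fil^r_1/Fil^r_{m+1}) ↠ H^{2r−1}(Fil^r_1/Fil^r_m)` (every staircase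
Bockstein vanishes); (A3) no weight-crossing differentials / strictness in weights `< p − 1` (Adams
operations: `ψ^ℓ = ℓ^w` on `gr^w`, `ℓ` a primitive root mod `p`; on abelian schemes `[−1]`-parity
suffices, cards isogeny-weight-parity / -eigenweight-splitting), so graded surjectivity lifts to `π₀`,
hence to `ker(K₀(X_m) → K₀(X_k)) = im(π₀K(X_m,X_1) → K₀(X_m))`. STATUS after the disprover's
cycle 2 (E1)–(E4): for `d ≤ 3` (A3) is EMPTY (the only weight-crossing differential into the
`0/−1`-stems is `d₁ : π₀gr¹ → π₋₁gr²`, and `π₀K → π₀gr¹ = ker(Pic X_m → Pic X_1)` is the relative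
determinant, surjective), so this stub is a paper theorem modulo the assembly (A1); for `d ≥ 4`
(`Ω¹` free) parity closes it on abelian schemes, open edge = non-trivial torsors (E7). Why it might
fail: (A3) for `d ≥ 4` off abelian schemes is not in print integrally (Bouis Thm 3 is rational); a level-wise integral `K₀`-vs-motivic discrepancy in
relative dimension `≥ 3` (first candidate level `X_2 → X_3` on an abelian or `K3 × E` threefold) would
break it — the disprover's lead, which the hypercohomology packaging survives (triage r1-3 F3b).
Calibrations passed: `r = 1` (`1 + p^m𝒪 ≅ 𝒪_{X_k}`, Berthelot–Ogus / Pic Bockstein — this is where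
`H²(𝒳,𝒪)[p] = 0` is used; Godeaux–Serre violates the hypothesis), `𝒳 = Spec W` all `r ≤ p − 2`
(Angeltveit arXiv:1101.1866 Thm 3, Antieau–Krause–Nikolaus arXiv:2204.03420), `d ≤ 2` (refuter
rattack-13825-0: a class lifts one level iff its determinant does). Sources: arXiv:2412.06635
Prop. 3.29, Thm 3, Thm 4(3); arXiv:2003.12541 Thm F(2), Ex. 6.2, Thm G; arXiv:1203.2776 Thm 54,
Claim 49, Prop. 43; Bhatt arXiv:1204.6560; Illusie, Complexe cotangent II ch. VIII. -/
theorem stub_kernelClassesLift :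
    ∀ (p : ℕ) [Fact p.Prime] (k : Type) [Field k] [CharP k p] [PerfectRing k p] (d : ℕ)
      (𝒳 : SchemeOver (WittVector p k)), IsSmoothProperModel d 𝒳 →
      Crystalline.IsProjectiveOverRing 𝒳 → d + 6 < p →
      (∀ (a b : ℕ) (x : hodgeCohomology 𝒳 a b), (p : ℤ) • x = 0 → x = 0) →
      ∀ (n : ℕ) (t : KTheory.KZero (thickening 𝒳 (n + 1)).left),
        KTheory.KZero.map (specialFibreToThickening 𝒳 n) t = 0 →
        ∃ t' : KTheory.KZero (thickening 𝒳 (n + 2)).left,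
          KTheory.KZero.map (thickeningMap 𝒳 (Nat.le_succ (n + 1))) t' = t := by
  sorry

/-- **stub_proImageSaturated** (size L; = the idea card's integral pro-lift IPL, i.e. the
disprover's (1_K) `IntegralCompatibleLift` for every class at once). For `k` perfect, `𝒳/W(k)` a
smooth proper model of relative dimension `d`, projective, `d + 6 < p`, with ALL `H^b(𝒳, Ω^a_{𝒳/W})`
`p`-torsion-free: the image of `lim_n K₀(X_{n+1}) → K₀(X_k)` (INTEGRAL compatible families
`(η_n)_n`, `η_n ∈ K₀(X_{n+1})`, restricted along `X_k ⥲ X_1`) is SATURATED in `K₀(X_k)`: if `N · x`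
pro-lifts for some `N ≠ 0` then `x` pro-lifts. (The crux's hypothesis "`[E₁] ⊗ 1` lifts to
`(lim_n K₀(X_n)) ⊗ ℚ`" says exactly that some `N · [E₁]`, `N ≠ 0`, pro-lifts integrally —
`exists_int_multiple_proLift_of_rationalProLift` below, proved.)
Paper proof (the line): the obstruction to pro-lifting is a homomorphism
`ob : K₀(X_k) → π₋₁K^{cts}(𝒳, X_k)` whose kernel is the pro-image (Milnor sequence; the `lim¹` term
vanishes: finite `W`-length transitions) and whose target is filtered with graded pieces
`H^{2r}_cont(X_k, p(r)Ω^{<r}_{X•}) ≅ H^{2r}(𝒳, (Ω^{<r}, p·d))` (Bloch–Esnault–Kerz Claim 49: INTEGRAL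
isomorphism of PRO-sheaves for `a < p − 2`, `{T}`-delooping of Thm 48 to avoid `K₋₁`; equivalently
`lim_m Fil^r_1/Fil^r_m = p(r)Ω^{<r}_𝒳`, the pro-limit of the staircase), TORSION-FREE under
torsion-free Hodge cohomology (Rem. 35(2): `E₁`-degenerate with free `E₁`), with no extension
torsion ((A3) at the pro level); so `N · ob(x) = ob(N · x) = 0` forces `ob(x) = 0`. STATUS after the
disprover's cycle 2 (E5): for `d ≤ 3`, `G_∞ = π₋₁ lim_m K(X_m, X_1)` is an extension of `H²(𝒳,𝒪)` by
`H³(𝒳,Ω¹)` (torsion-free; `Disproof.noTorsion_of_extension`, `ob_eq_zero_of_rational_lift`), so the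
stub is a paper theorem modulo the assembly (A1) there. Why it might fail:
extension/differential torsion in `π₋₁K^{cts}` for `d ≥ 4` (quotients of torsion-free groups by
non-saturated images); the refuter's `C_tors` scenario (a `p`-power torsion class of `K₀(X_k)` on a
Hodge-torsion-free threefold that does not lift to `K₀(X_2)`) refutes it directly. Where
`H²(𝒳,𝒪)[p] = 0` is used: weight `r = 1` (the pro-obstruction group of `det x` is `H²(𝒳, 𝒪)`;
Godeaux–Serre: `[L₁^p]` pro-lifts, `[L₁]` does not). Sources: arXiv:1203.2776 §8 Def 32–Thm 36,
Rem 35(2), §9 Def 38–39, §10 Prop 43, §11 Thm 48 + Claim 49/50; arXiv:2003.12541 Question 1.4,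
Thm D/E; Langer, Doc. Math. 23 (2018) Thm 0.1–0.3 (cycle-level analogue). -/
theorem stub_proImageSaturated :
    ∀ (p : ℕ) [Fact p.Prime] (k : Type) [Field k] [CharP k p] [PerfectRing k p] (d : ℕ)
      (𝒳 : SchemeOver (WittVector p k)), IsSmoothProperModel d 𝒳 →
      Crystalline.IsProjectiveOverRing 𝒳 → d + 6 < p →
      (∀ (a b : ℕ) (x : hodgeCohomology 𝒳 a b), (p : ℤ) • x = 0 → x = 0) →
      ∀ (x : KTheory.KZero (specialFibre 𝒳).left) (N : ℤ), N ≠ 0 →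
        (∃ η : ∀ n : ℕ, KTheory.KZero (thickening 𝒳 (n + 1)).left,
          (∀ n, KTheory.KZero.map (thickeningMap 𝒳 (Nat.le_succ (n + 1))) (η (n + 1)) = η n) ∧
          KTheory.KZero.map (specialFibreToThickening 𝒳 0) (η 0) = N • x) →
        ∃ η : ∀ n : ℕ, KTheory.KZero (thickening 𝒳 (n + 1)).left,
          (∀ n, KTheory.KZero.map (thickeningMap 𝒳 (Nat.le_succ (n + 1))) (η (n + 1)) = η n) ∧
          KTheory.KZero.map (specialFibreToThickening 𝒳 0) (η 0) = x := by
  sorry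

/-! ## Proved glue, part 1: full Hodge torsion-freeness from the typed hypotheses + stub 1 -/

section HodgeTF

variable {p : ℕ} [Fact p.Prime] {k : Type} [Field k]

/-- Typed torsion-freeness of `H^b(𝒳,𝒪)` (`structureSheafCohomology`) and `H^b(𝒳,Ω¹)`
(`hodgeCohomologyOne`) plus the conclusion of `stub_hodgeTorsionFree` (`a ≥ 2`) give
torsion-freeness of every `hodgeCohomology 𝒳 a b`: for `a = 0, 1` transport along the tree's
`hodgeCohomologyZeroAddEquiv : H^b(Ω⁰) ≃+ H^b(𝒪)` and `hodgeCohomologyOneAddEquiv : H^b(⋀¹Ω¹) ≃+ H^b(Ω¹)`. -/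
theorem hodgeTorsionFree_all (𝒳 : SchemeOver (WittVector p k))
    (hO : ∀ (b : ℕ) (x : structureSheafCohomology 𝒳.left b), (p : ℤ) • x = 0 → x = 0)
    (hΩ : ∀ (b : ℕ) (x : hodgeCohomologyOne 𝒳 b), (p : ℤ) • x = 0 → x = 0)
    (h₂ : ∀ (a b : ℕ), 2 ≤ a → ∀ x : hodgeCohomology 𝒳 a b, (p : ℤ) • x = 0 → x = 0) :
    ∀ (a b : ℕ) (x : hodgeCohomology 𝒳 a b), (p : ℤ) • x = 0 → x = 0 := by
  intro a b x hx
  rcases a with _ | _ | a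
  · have e : hodgeCohomology 𝒳 0 b ≃+ structureSheafCohomology 𝒳.left b :=
      hodgeCohomologyZeroAddEquiv 𝒳 b
    have h0 : e x = 0 := hO b (e x) (by rw [← map_zsmul e, hx, map_zero])
    exact (AddEquiv.map_eq_zero_iff e).mp h0
  · have e : hodgeCohomology 𝒳 1 b ≃+ hodgeCohomologyOne 𝒳 b := hodgeCohomologyOneAddEquiv 𝒳 b
    have h0 : e x = 0 := hΩ b (e x) (by rw [← map_zsmul e, hx, map_zero])
    exact (AddEquiv.map_eq_zero_iff e).mp h0
  · exact h₂ _ b (by omega) x hx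

end HodgeTF

/-! ## Proved glue, part 2: the crux's `KTheory` tower IS the `WittScheme` tower -/

section Tower

variable {p : ℕ} [Fact p.Prime] {k : Type} [Field k] (𝒳 : SchemeOver (WittVector p k))

/-- The `n`-th stage `𝒳 ×_W Spec(W/p^{n+1})` of the `KTheory` tower (in which the crux's rational
pro-class hypothesis `ContinuousKZeroRat (p) 𝒳` lives) is DEFINITIONALLY the underlying scheme of
the `WittScheme` thickening `X_{n+1}` (in which (⋆) and `LiftsFormally` live): transport of classes,
as the identity. -/
noncomputable def toWitt (n : ℕ) :
    KTheory.KZero (KTheory.thickening (Ideal.span {(p : WittVector p k)}) 𝒳 n) →+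
      KTheory.KZero (thickening 𝒳 (n + 1)).left :=
  AddMonoidHom.id _

/-- The transition maps of the two towers agree. -/
theorem thickeningMap_eq_thickeningTransition (n : ℕ) :
    thickeningMap 𝒳 (Nat.le_succ (n + 1)) =
      KTheory.thickeningTransition (Ideal.span {(p : WittVector p k)}) 𝒳 n := by
  -- Both sides are `pullback.lift`s into `X_{n+2}`; compare the two projections. `erw` abstracts
  -- the `pullback.lift _ _ _ ≫ pullback.fst _ _` redex on BOTH sides at once (the two presentations
  -- of the tower are definitionally equal), after which the two sides coincide syntactically and
  -- the rewrite's closing `rfl` finishes; one rewrite per projection.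
  refine pullback.hom_ext ?_ ?_
  · unfold thickeningMap KTheory.thickeningTransition KTheory.thickeningι
    erw [pullback.lift_fst]
  · unfold thickeningMap KTheory.thickeningTransition KTheory.thickeningStructureMap
      KTheory.truncSpecTransition
    erw [pullback.lift_snd]

/-- Pulling a transported class back one step of the `WittScheme` tower = transporting its pull-back
along the `KTheory` transition. -/
theorem map_thickeningMap_toWitt (n : ℕ)
    (y : KTheory.KZero (KTheory.thickening (Ideal.span {(p : WittVector p k)}) 𝒳 (n + 1))) :
    KTheory.KZero.map (thickeningMap 𝒳 (Nat.le_succ (n + 1))) (toWitt 𝒳 (n + 1) y) =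
      toWitt 𝒳 n (KTheory.KZero.map
        (KTheory.thickeningTransition (Ideal.span {(p : WittVector p k)}) 𝒳 n) y) := by
  rw [thickeningMap_eq_thickeningTransition]
  rfl

variable [CharP k p]

/-- The crux's `Crystalline.specialFibreToTower 𝒳 : X_k ⟶ 𝒳 ⊗ W/p` IS `specialFibreToThickening 𝒳 0`
(definitionally), so restriction to `X_k` commutes with the transport. -/
theorem map_specialFibreToThickening_toWitt
    (y : KTheory.KZero (KTheory.thickening (Ideal.span {(p : WittVector p k)}) 𝒳 0)) :
    KTheory.KZero.map (specialFibreToThickening 𝒳 0) (toWitt 𝒳 0 y) =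
      KTheory.KZero.map (Crystalline.specialFibreToTower 𝒳) y :=
  rfl

/-- **Clearing denominators in the crux's rational pro-class hypothesis** (proved): if
`[E₁] ⊗ 1 ∈ K₀(X_k) ⊗ ℚ` is the restriction of some `ξ ∈ (lim_n K₀(X_n)) ⊗_ℤ ℚ` (the tree's
`ContinuousKZeroRat`, `⊗ ℚ` AFTER the limit — so `ξ = (1/s) ⊗ η` with `η` an INTEGRAL pro-class), then
for some integer `N ≠ 0` the class `N · [E₁]` is the restriction of an integral compatible family
on the `WittScheme` tower. (`IsLocalizedModule` for `M → ℚ ⊗_ℤ M`: surjectivity up to denominators,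
and kernel = torsion.) -/
theorem exists_int_multiple_proLift_of_rationalProLift
    {E₁ : (specialFibre 𝒳).left.Modules} (hE₁ : IsFiniteLocallyFree E₁)
    (hr : RationalProLift 𝒳 E₁ hE₁) :
    ∃ N : ℤ, N ≠ 0 ∧ ∃ η : ∀ n : ℕ, KTheory.KZero (thickening 𝒳 (n + 1)).left,
      (∀ n, KTheory.KZero.map (thickeningMap 𝒳 (Nat.le_succ (n + 1))) (η (n + 1)) = η n) ∧
      KTheory.KZero.map (specialFibreToThickening 𝒳 0) (η 0) = N • KTheory.KZero.of E₁ hE₁ := by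
  obtain ⟨ξ, hξ⟩ := hr
  -- clear denominators in `ℚ ⊗_ℤ lim_n K₀(X_n)`: `s • ξ = 1 ⊗ η`
  obtain ⟨⟨η, s⟩, hs⟩ := IsLocalizedModule.surj (nonZeroDivisors ℤ)
    (TensorProduct.mk ℤ ℚ (KTheory.LimKZero (Ideal.span {(p : WittVector p k)}) 𝒳) 1) ξ
  -- restrict to the special fibre: `s • ([E₁] ⊗ 1) = 1 ⊗ (η₀|_{X_k})`
  have key : (s : ℤ) • KTheory.KZeroRat.of E₁ hE₁ =
      (1 : ℚ) ⊗ₜ[ℤ] KTheory.KZero.map (Crystalline.specialFibreToTower 𝒳)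
        ((η : ∀ m, KTheory.KZero (KTheory.thickening (Ideal.span {(p : WittVector p k)}) 𝒳 m)) 0) := by
    have := congrArg (fun ζ => KTheory.KZeroRat.map (Crystalline.specialFibreToTower 𝒳)
      (KTheory.ContinuousKZeroRat.specialFibre (Ideal.span {(p : WittVector p k)}) 𝒳 ζ)) hs
    simp only [Submonoid.smul_def, map_zsmul, hξ, TensorProduct.mk_apply,
      KTheory.ContinuousKZeroRat.proj_tmul, KTheory.KZeroRat.map_tmul,
      KTheory.LimKZero.proj_apply] at this
    exact this
  -- kernel of `K₀(X_k) → K₀(X_k) ⊗ ℚ` is torsion: `c • η₀|_{X_k} = c • s • [E₁]`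
  have h1 : (TensorProduct.mk ℤ ℚ (KTheory.KZero (specialFibre 𝒳).left) 1)
        (KTheory.KZero.map (Crystalline.specialFibreToTower 𝒳)
          ((η : ∀ m, KTheory.KZero (KTheory.thickening (Ideal.span {(p : WittVector p k)}) 𝒳 m)) 0)) =
      (TensorProduct.mk ℤ ℚ (KTheory.KZero (specialFibre 𝒳).left) 1)
        ((s : ℤ) • KTheory.KZero.of E₁ hE₁) := by
    simp only [TensorProduct.mk_apply]
    rw [← key, KTheory.KZeroRat.of, TensorProduct.tmul_smul]
  obtain ⟨c, hc⟩ := (IsLocalizedModule.eq_iff_exists (nonZeroDivisors ℤ)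
    (TensorProduct.mk ℤ ℚ (KTheory.KZero (specialFibre 𝒳).left) 1)).mp h1
  refine ⟨(c : ℤ) * (s : ℤ),
    mul_ne_zero (nonZeroDivisors.coe_ne_zero c) (nonZeroDivisors.coe_ne_zero s),
    fun n => toWitt 𝒳 n ((c : ℤ) •
      (η : ∀ m, KTheory.KZero (KTheory.thickening (Ideal.span {(p : WittVector p k)}) 𝒳 m)) n),
    fun n => ?_, ?_⟩
  · rw [map_thickeningMap_toWitt, map_zsmul]
    exact congrArg (fun y => toWitt 𝒳 n ((c : ℤ) • y)) (η.2 n)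
  · rw [map_specialFibreToThickening_toWitt, map_zsmul, mul_smul]
    simpa only [Submonoid.smul_def] using hc

end Tower

/-! ## The composition -/

/-- **Composition, implication form** (kernel-checked, no `sorry`, axioms
`propext/Classical.choice/Quot.sound`): the three stub STATEMENTS imply the hypothesis of the
disprover's proved reduction `crux_of_oneK_twoK`, i.e. "(crux hypotheses) ⇒ RationalProLift ⇒
(1_K) IntegralCompatibleLift ∧ (2_K) KernelTowerSurjective". Route: typed hypotheses ⟶ (stub 1 +
`hodgeTorsionFree_all`) full Hodge torsion-freeness; rational pro-class ⟶
(`exists_int_multiple_proLift_of_rationalProLift`) `N · [E₁]` pro-lifts integrally ⟶ (stub 3) (1_K);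
(stub 2) + `Disproof.specialFibreToThickening_comp_thickeningMap` ⟶ (2_K). (Stated with this
conclusion rather than the crux itself so that exactly ONE theorem of the file concludes the crux:
`FormalLiftingFromClassLifting_of`, hypothesis-free, from the stubs by name.) -/
theorem oneK_twoK_of_stubs
    (h₁ : ∀ (p : ℕ) [Fact p.Prime] (k : Type) [Field k] [CharP k p] [PerfectRing k p] (d : ℕ)
      (𝒳 : SchemeOver (WittVector p k)), IsSmoothProperModel d 𝒳 →
      Crystalline.IsProjectiveOverRing 𝒳 →
      (∀ (b : ℕ) (x : structureSheafCohomology 𝒳.left b), (p : ℤ) • x = 0 → x = 0) →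
      (∀ (b : ℕ) (x : hodgeCohomologyOne 𝒳 b), (p : ℤ) • x = 0 → x = 0) →
      (d ≤ 3 ∨ Nonempty (cotangentSheaf 𝒳 ≅ SheafOfModules.free (R := 𝒳.left.ringCatSheaf) (Fin d))) →
      ∀ (a b : ℕ), 2 ≤ a → ∀ x : hodgeCohomology 𝒳 a b, (p : ℤ) • x = 0 → x = 0)
    (h₂ : ∀ (p : ℕ) [Fact p.Prime] (k : Type) [Field k] [CharP k p] [PerfectRing k p] (d : ℕ)
      (𝒳 : SchemeOver (WittVector p k)), IsSmoothProperModel d 𝒳 →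
      Crystalline.IsProjectiveOverRing 𝒳 → d + 6 < p →
      (∀ (a b : ℕ) (x : hodgeCohomology 𝒳 a b), (p : ℤ) • x = 0 → x = 0) →
      ∀ (n : ℕ) (t : KTheory.KZero (thickening 𝒳 (n + 1)).left),
        KTheory.KZero.map (specialFibreToThickening 𝒳 n) t = 0 →
        ∃ t' : KTheory.KZero (thickening 𝒳 (n + 2)).left,
          KTheory.KZero.map (thickeningMap 𝒳 (Nat.le_succ (n + 1))) t' = t)
    (h₃ : ∀ (p : ℕ) [Fact p.Prime] (k : Type) [Field k] [CharP k p] [PerfectRing k p] (d : ℕ)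
      (𝒳 : SchemeOver (WittVector p k)), IsSmoothProperModel d 𝒳 →
      Crystalline.IsProjectiveOverRing 𝒳 → d + 6 < p →
      (∀ (a b : ℕ) (x : hodgeCohomology 𝒳 a b), (p : ℤ) • x = 0 → x = 0) →
      ∀ (x : KTheory.KZero (specialFibre 𝒳).left) (N : ℤ), N ≠ 0 →
        (∃ η : ∀ n : ℕ, KTheory.KZero (thickening 𝒳 (n + 1)).left,
          (∀ n, KTheory.KZero.map (thickeningMap 𝒳 (Nat.le_succ (n + 1))) (η (n + 1)) = η n) ∧
          KTheory.KZero.map (specialFibreToThickening 𝒳 0) (η 0) = N • x) →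
        ∃ η : ∀ n : ℕ, KTheory.KZero (thickening 𝒳 (n + 1)).left,
          (∀ n, KTheory.KZero.map (thickeningMap 𝒳 (Nat.le_succ (n + 1))) (η (n + 1)) = η n) ∧
          KTheory.KZero.map (specialFibreToThickening 𝒳 0) (η 0) = x) :
    ∀ (p : ℕ) [Fact p.Prime] (k : Type) [Field k] [CharP k p] [PerfectRing k p] (d : ℕ)
      (𝒳 : SchemeOver (WittVector p k)), IsSmoothProperModel d 𝒳 →
      Crystalline.IsProjectiveOverRing 𝒳 → d + 6 < p → HodgeTorsionFree 𝒳 d →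
      ∀ (E₁ : (specialFibre 𝒳).left.Modules) (hE₁ : IsFiniteLocallyFree E₁),
        RationalProLift 𝒳 E₁ hE₁ → IntegralCompatibleLift 𝒳 E₁ hE₁ ∧ KernelTowerSurjective 𝒳 := by
  intro p _ k _ _ _ d 𝒳 h𝒳 hproj hp hH E₁ hE₁ hr
  -- full Hodge torsion-freeness (stub 1 normalises the typed disjunction)
  have htf : ∀ (a b : ℕ) (x : hodgeCohomology 𝒳 a b), (p : ℤ) • x = 0 → x = 0 :=
    hodgeTorsionFree_all 𝒳 hH.1 hH.2.1 (h₁ p k d 𝒳 h𝒳 hproj hH.1 hH.2.1 hH.2.2)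
  refine ⟨?_, ?_⟩
  · -- (1_K): clear denominators, then saturation (stub 3)
    obtain ⟨N, hN, η, hη, hη0⟩ := exists_int_multiple_proLift_of_rationalProLift 𝒳 hE₁ hr
    exact h₃ p k d 𝒳 h𝒳 hproj hp htf (KTheory.KZero.of E₁ hE₁) N hN ⟨η, hη, hη0⟩
  · -- (2_K): kernel classes lift (stub 2); the lift is again a kernel class
    intro n t ht
    obtain ⟨t', ht'⟩ := h₂ p k d 𝒳 h𝒳 hproj hp htf n t ht
    refine ⟨t', ?_, ht'⟩
    rw [← specialFibreToThickening_comp_thickeningMap 𝒳 n, KTheory.KZero.map_comp_apply, ht']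
    exact ht

/-- **Composition** — the ONLY theorem of this file concluding the crux, and it does so BY NAME,
hypothesis-free, from the three registered stubs by name (no `sorry` of its own; `sorryAx` enters
only through `stub_hodgeTorsionFree`, `stub_kernelClassesLift`, `stub_proImageSaturated`): the
disprover's proved `crux_of_oneK_twoK` ((1_K) ∧ (2_K) ⇒ integral step class lifting ⇒ with (⋆),
`LiftsFormally`) applied to `oneK_twoK_of_stubs`. -/
theorem FormalLiftingFromClassLifting_of :
    Summit.HodgeConjecture.HodgeConjecture.Theses.PadicSemiregularLift.FormalLiftingFromClassLifting :=
  crux_of_oneK_twoK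
    (oneK_twoK_of_stubs stub_hodgeTorsionFree stub_kernelClassesLift stub_proImageSaturated)

end Summit.HodgeConjecture.HodgeConjecture.Cruxes.FormalLiftingFromClassLifting.SyntomicStaircase
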